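import Summits.QuantumAdvantage.QuantumAdvantage.Theorems.CubicForrelationNearExactIsExactCubicFormHyperplane
import Summits.QuantumAdvantage.QuantumAdvantage.Theorems.CubicForrelationNearExactIsExactCubicFormSymplectic
import Summits.QuantumAdvantage.QuantumAdvantage.Theorems.CubicForrelationNearExactIsExactCubicFormDickson

/-!
# Crux `CubicForrelation.NearExactIsExact` (stmt-QuantumAdvantage-14043) — a QUADRATIC has a maximal symplectic frame, hence a Dickson bound

Certificate seat `b2b-cforr-cert` (gen 40).  HONEST FRAMING: kernel-checked glue (standard axioms) of …CubicFormSymplectic (`tcs_frame_exists`),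
…CubicFormHyperplane (`tch_second_const`) and …CubicFormDickson (`tcd_frame_card`) — tools T5/T6 of the Lean roadmap for `E1280-even`
(HOME/b2b-cforr-cert-g40/LEAN-PLAN-E1280-EVEN.md §3), in the form the cell lemmas of the light-cell analysis will consume.  Nothing about
`θ₁₂`; NOT summit progress.

* `tcq_form_symm`, `tcq_form_alt`: the second-difference form `B(v,w) = q(0) ⊕ q(w) ⊕ q(v) ⊕ q(v ⊕ w)` of any `q` is symmetric with
  `B(v,v) = 0`.
* `tcq_dickson` (**main**): for `deg q ≤ 2` on `n` bits there are `h ≤ n` and a MAXIMAL symplectic frame `(bᵢ, cᵢ)_{i<h}` of `B` (frame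
  identities at every base point; `B` vanishes on the frame-orthogonal vectors) with `|2ⁿ − 2·#{q = 1}| ≤ 2^{n−h}`.

References: L. E. Dickson (1901); F. J. MacWilliams, N. J. A. Sloane (1977) Ch. 15 §2.  Axioms: the standard three.
-/

set_option linter.dupNamespace false -- D-0017: single-problem summit ⇒ `QuantumAdvantage.QuantumAdvantage` by design

namespace Summit.QuantumAdvantage.QuantumAdvantage.Theorems.CubicForrelation.NearExactIsExact

open Finset
open Literature.Computability.QuantumComplexity
open Literature.Computability.QuantumComplexity.BuzetChailloux (bxor zeroVec bxor_comm bxor_self bxor_zeroVec zeroVec_bxor)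

variable {n : ℕ}

/-- The second-difference form at `0` is symmetric. [folklore] -/
theorem tcq_form_symm (q : (Fin n → Bool) → Bool) (v w : Fin n → Bool) :
    ((q zeroVec ^^ q (bxor zeroVec w)) ^^ (q (bxor zeroVec v) ^^ q (bxor (bxor zeroVec v) w))) =
      ((q zeroVec ^^ q (bxor zeroVec v)) ^^ (q (bxor zeroVec w) ^^ q (bxor (bxor zeroVec w) v))) := by
  simp only [zeroVec_bxor]
  rw [bxor_comm w v]
  have key : ∀ a b c d : Bool, ((a ^^ b) ^^ (c ^^ d)) = ((a ^^ c) ^^ (b ^^ d)) := by decide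
  exact key _ _ _ _

/-- The second-difference form at `0` vanishes on the diagonal. [folklore] -/
theorem tcq_form_alt (q : (Fin n → Bool) → Bool) (v : Fin n → Bool) :
    ((q zeroVec ^^ q (bxor zeroVec v)) ^^ (q (bxor zeroVec v) ^^ q (bxor (bxor zeroVec v) v))) = false := by
  rw [zeroVec_bxor, bxor_self]
  have key : ∀ a b : Bool, ((a ^^ b) ^^ (b ^^ a)) = false := by decide
  exact key _ _

/-- **Dickson via a maximal frame.**  For `deg q ≤ 2` on `n` bits there are `h ≤ n` and vectors `bᵢ, cᵢ` (`i < h`) such that, at EVERY base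
point `x`, `q(x) ⊕ q(x⊕bᵢ) ⊕ q(x⊕cⱼ) ⊕ q(x⊕cⱼ⊕bᵢ) = [i = j]`, `q(x) ⊕ q(x⊕bᵢ) ⊕ q(x⊕bⱼ) ⊕ q(x⊕bⱼ⊕bᵢ) = 0`, the same for the `c`'s, the frame
is maximal (the form vanishes on vectors orthogonal to all `bᵢ, cᵢ`), and `2ⁿ ≤ 2#{q=1} + 2^{n−h}`, `2#{q=1} ≤ 2ⁿ + 2^{n−h}`.
[cite: MacWilliamsSloane1977, Ch. 15 §2 Thm 4] -/
theorem tcq_dickson (q : (Fin n → Bool) → Bool) (hq : IsDegLeFun 2 q) :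
    ∃ (h : ℕ) (b c : Fin h → (Fin n → Bool)), h ≤ n ∧
      (∀ i x, ((q x ^^ q (bxor x (b i))) ^^ (q (bxor x (c i)) ^^ q (bxor (bxor x (c i)) (b i)))) = true) ∧
      (∀ i j x, i ≠ j → ((q x ^^ q (bxor x (b i))) ^^ (q (bxor x (c j)) ^^ q (bxor (bxor x (c j)) (b i)))) = false) ∧
      (∀ i j x, ((q x ^^ q (bxor x (b i))) ^^ (q (bxor x (b j)) ^^ q (bxor (bxor x (b j)) (b i)))) = false) ∧
      (∀ i j x, ((q x ^^ q (bxor x (c i))) ^^ (q (bxor x (c j)) ^^ q (bxor (bxor x (c j)) (c i)))) = false) ∧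
      (∀ v w : Fin n → Bool,
        (∀ i, ((q zeroVec ^^ q (bxor zeroVec (b i))) ^^ (q (bxor zeroVec v) ^^ q (bxor (bxor zeroVec v) (b i)))) = false) →
        (∀ i, ((q zeroVec ^^ q (bxor zeroVec (c i))) ^^ (q (bxor zeroVec v) ^^ q (bxor (bxor zeroVec v) (c i)))) = false) →
        (∀ i, ((q zeroVec ^^ q (bxor zeroVec (b i))) ^^ (q (bxor zeroVec w) ^^ q (bxor (bxor zeroVec w) (b i)))) = false) →
        (∀ i, ((q zeroVec ^^ q (bxor zeroVec (c i))) ^^ (q (bxor zeroVec w) ^^ q (bxor (bxor zeroVec w) (c i)))) = false) →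
        ((q zeroVec ^^ q (bxor zeroVec w)) ^^ (q (bxor zeroVec v) ^^ q (bxor (bxor zeroVec v) w))) = false) ∧
      2 ^ n ≤ 2 * #(univ.filter fun x : Fin n → Bool => q x = true) + 2 ^ (n - h) ∧
      2 * #(univ.filter fun x : Fin n → Bool => q x = true) ≤ 2 ^ n + 2 ^ (n - h) := by
  -- the form at base point `0`
  set B : (Fin n → Bool) → (Fin n → Bool) → Bool :=
    fun v w => (q zeroVec ^^ q (bxor zeroVec w)) ^^ (q (bxor zeroVec v) ^^ q (bxor (bxor zeroVec v) w)) with hB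
  have hsymm : ∀ v w, B v w = B w v := fun v w => tcq_form_symm q v w
  have halt : ∀ v, B v v = false := fun v => tcq_form_alt q v
  -- base-point independence (degree ≤ 2)
  have hbase : ∀ v w x, ((q x ^^ q (bxor x w)) ^^ (q (bxor x v) ^^ q (bxor (bxor x v) w))) = B v w :=
    fun v w x => tch_second_const q hq v w x
  obtain ⟨h, b, c, h1, h2, h3, h4, hmax⟩ := tcs_frame_exists B hsymm halt
  -- the frame identities at every base point, in the orientation of `tcd_frame_card`
  have f1 : ∀ i x, ((q x ^^ q (bxor x (b i))) ^^ (q (bxor x (c i)) ^^ q (bxor (bxor x (c i)) (b i)))) = true := by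
    intro i x; rw [hbase (c i) (b i) x, hsymm]; exact h1 i
  have f2 : ∀ i j x, i ≠ j → ((q x ^^ q (bxor x (b i))) ^^ (q (bxor x (c j)) ^^ q (bxor (bxor x (c j)) (b i)))) = false := by
    intro i j x hij; rw [hbase (c j) (b i) x, hsymm]; exact h2 i j hij
  have f3 : ∀ i j x, ((q x ^^ q (bxor x (b i))) ^^ (q (bxor x (b j)) ^^ q (bxor (bxor x (b j)) (b i)))) = false := by
    intro i j x; rw [hbase (b j) (b i) x]; exact h3 j i
  have f4 : ∀ i j x, ((q x ^^ q (bxor x (c i))) ^^ (q (bxor x (c j)) ^^ q (bxor (bxor x (c j)) (c i)))) = false := by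
    intro i j x; rw [hbase (c j) (c i) x]; exact h4 j i
  obtain ⟨hhn, hlo, hhi⟩ := tcd_frame_card q h b c f1 f2 f3
  refine ⟨h, b, c, hhn, f1, f2, f3, f4, fun v w hvb hvc hwb hwc => ?_, hlo, hhi⟩
  -- maximality
  exact hmax v w (fun i => hvb i) (fun i => hvc i) (fun i => hwb i) (fun i => hwc i)

end Summit.QuantumAdvantage.QuantumAdvantage.Theorems.CubicForrelation.NearExactIsExact
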